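import Literature.NumberTheory.LFunctions.TaoLogElliottLogAvg
import HarnessLib

/-!
# Tao's log-averaged Elliott theorem: Proposition 2.6, the computation at a single prime

Part of the proof DAG below the named fact `Literature.NumberTheory.LFunctions.Tao2016_theorem23_core` (Tao, Forum Math. Pi 4
(2016) e8, the proof of Theorem 2.3).  Proposition 2.6 ("we can exploit the multiplicativity of
`g₁, g₂` at medium-sized primes to average [the lower bound (2.14)]") rests on the following
computation for one prime `p` coprime to `a`, which is PROVED here from the tree's quantitative
Lemma 2.5 (`TaoLogElliottLogAvg.lean`):

* the exact identity from complete multiplicativity (the display before (2.16)):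
  `1_{𝐧 ≡ b (a)} g₁(𝐧) g₂(𝐧+h) = c_p 1_{p𝐧 ≡ pb (ap)} g₁(p𝐧) g₂(p𝐧+ph)`, `c_p = ḡ₁(p) ḡ₂(p)`
  (`cCoeff`, `cCoeff_mul_mul`; used inside the proof of `norm_logAvg_Zpj_sub_le`);
* display (2.16) = "(toc)": for `1 ≤ j ≤ H`,
  `𝔼 c_p 1_{𝐧+j ≡ pb (ap)} g₁(𝐧+j) g₂(𝐧+j+ph) = (1/p) X + o_{A→∞}(1)`,
  `X = 𝔼 1_{𝐧 ≡ b (a)} g₁(𝐧) g₂(𝐧+h)` — `norm_logAvg_Zpj_sub_le`, with the explicit error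
  `(8 + 2 log p)/S + 4(H+1)/(pS)`, `S = ∑_{x/ω<n≤x} 1/n` ("we split `1_{𝐧+j ≡ pb (ap)}` as
  `1_{𝐧 ≡ -j (p)} 1_{𝐧+j ≡ pb (a)}` and apply Lemma 2.5").

The remaining steps of the proof of Proposition 2.6 (summation over `j`, the quantities `Q(s)`,
summation over `𝒫_H`, the final application of Lemma 2.5 with `q = a`, and the restriction to
`j + ph ∈ [1, H]`) are bookkeeping over these estimates.

## References
* T. Tao, Forum Math. Pi 4 (2016), e8; arXiv:1509.05422, §2, Proposition 2.6 and its proof up to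
  display (2.16).

## Design choices
* Integer arguments are fed to `g₁, g₂ : ℕ → ℂ` through `Int.toNat`, as in
  `Literature.NumberTheory.LFunctions.Tao2016_theorem23` / `Literature.NumberTheory.LFunctions.Tao2016.seqAt`; `b, h, j ∈ ℤ`.
* Besides complete multiplicativity and unimodularity on `ℕ₊`, we assume `|gᵢ 0| ≤ 1` (harmless:
  the value at `0` never occurs on the range of `𝐧`, and the core argument may normalise
  `gᵢ 0 = 0`), so that the integrands are globally `1`-bounded as `TaoLogElliottLogAvg` requires.
* The range condition `|h| + 1 ≤ x/ω` guarantees `𝐧 + h ≥ 1` (in the paper `𝐧 > x/ω ≥ log x`).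
-/

open Finset Real Complex

open scoped ComplexConjugate

namespace Literature.NumberTheory.LFunctions

namespace Tao2016

/-! ### Generalities on `logAvg` -/

/-- `𝔼` only sees the values on the range `x/ω < n ≤ x`. [folklore] -/
theorem logAvg_congr {X Y : ℕ → ℂ} {x ω : ℝ} (h : ∀ n ∈ Ioc ⌊x / ω⌋₊ ⌊x⌋₊, X n = Y n) :
    logAvg X x ω = logAvg Y x ω := by
  unfold logAvg wsum
  rw [sum_congr rfl fun n hn => by rw [h n hn]]

/-- On the range of `𝐧`, `n ≥ ⌊x/ω⌋ + 1 > x/ω`. [folklore] -/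
theorem lt_of_mem_range {x ω : ℝ} {n : ℕ} (hn : n ∈ Ioc ⌊x / ω⌋₊ ⌊x⌋₊) : x / ω < n := by
  have h1 := (mem_Ioc.1 hn).1
  have h2 : x / ω < (⌊x / ω⌋₊ : ℝ) + 1 := Nat.lt_floor_add_one _
  have h3 : ((⌊x / ω⌋₊ + 1 : ℕ) : ℝ) ≤ n := by exact_mod_cast h1
  push_cast at h3
  linarith

/-! ### The integrands -/

/-- Tao's coefficient `c_p = ḡ₁(p) ḡ₂(p) ∈ S¹` (Tao 2016, Proposition 2.6).
[cite: TaoFMP2016, Proposition 2.6] -/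
noncomputable def cCoeff (g₁ g₂ : ℕ → ℂ) (p : ℕ) : ℂ := conj (g₁ p) * conj (g₂ p)

/-- `|c_p| ≤ 1` when `|gᵢ| ≤ 1`. [folklore] -/
theorem norm_cCoeff_le {g₁ g₂ : ℕ → ℂ} (hb₁ : ∀ n, ‖g₁ n‖ ≤ 1) (hb₂ : ∀ n, ‖g₂ n‖ ≤ 1) (p : ℕ) :
    ‖cCoeff g₁ g₂ p‖ ≤ 1 := by
  unfold cCoeff
  rw [norm_mul, Complex.norm_conj, Complex.norm_conj]
  exact mul_le_one₀ (hb₁ p) (norm_nonneg _) (hb₂ p)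

/-- `c_p g₁(p) g₂(p) = 1` for unimodular values at `p`. [folklore] -/
theorem cCoeff_mul_mul {g₁ g₂ : ℕ → ℂ} {p : ℕ} (h₁ : ‖g₁ p‖ = 1) (h₂ : ‖g₂ p‖ = 1) :
    cCoeff g₁ g₂ p * g₁ p * g₂ p = 1 := by
  unfold cCoeff
  have e1 : conj (g₁ p) * g₁ p = 1 := by
    rw [mul_comm, Complex.mul_conj, Complex.normSq_eq_norm_sq, h₁]; simp
  have e2 : conj (g₂ p) * g₂ p = 1 := by
    rw [mul_comm, Complex.mul_conj, Complex.normSq_eq_norm_sq, h₂]; simp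
  calc conj (g₁ p) * conj (g₂ p) * g₁ p * g₂ p = (conj (g₁ p) * g₁ p) * (conj (g₂ p) * g₂ p) := by
        ring
    _ = 1 := by rw [e1, e2, one_mul]

/-- The integrand of (2.14): `V(n) = 1_{n ≡ b (a)} g₁(n) g₂(n + h)`.
[cite: TaoFMP2016, (2.14)] -/
noncomputable def corrInd (a : ℕ) (b h : ℤ) (g₁ g₂ : ℕ → ℂ) : ℕ → ℂ := fun n =>
  if (n : ℤ) ≡ b [ZMOD a] then g₁ n * g₂ ((n : ℤ) + h).toNat else 0

/-- The integrand of (2.16): `Z_{p,j}(n) = c_p 1_{n + j ≡ pb (ap)} g₁(n+j) g₂(n+j+ph)`.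
[cite: TaoFMP2016, (2.16)] -/
noncomputable def Zpj (a : ℕ) (b h : ℤ) (g₁ g₂ : ℕ → ℂ) (p : ℕ) (j : ℤ) : ℕ → ℂ := fun n =>
  if ((a * p : ℕ) : ℤ) ∣ (n : ℤ) + j - p * b then
    cCoeff g₁ g₂ p * g₁ ((n : ℤ) + j).toNat * g₂ ((n : ℤ) + j + p * h).toNat else 0

/-- `|V(n)| ≤ 1`. [folklore] -/
theorem norm_corrInd_le {a : ℕ} {b h : ℤ} {g₁ g₂ : ℕ → ℂ} (hb₁ : ∀ n, ‖g₁ n‖ ≤ 1)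
    (hb₂ : ∀ n, ‖g₂ n‖ ≤ 1) (n : ℕ) : ‖corrInd a b h g₁ g₂ n‖ ≤ 1 := by
  unfold corrInd
  split_ifs
  · rw [norm_mul]; exact mul_le_one₀ (hb₁ _) (norm_nonneg _) (hb₂ _)
  · simp

/-! ### The splitting `1_{n+j ≡ pb (ap)} = 1_{n ≡ -j (p)} · 1_{n+j ≡ pb (a)}` -/

/-- For `p` coprime to `a`: `ap ∣ m - pb ↔ (p ∣ m ∧ a ∣ m - pb)`. [folklore] -/
theorem mul_dvd_sub_iff {a p : ℕ} (hap : Nat.Coprime a p) (m b : ℤ) :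
    ((a * p : ℕ) : ℤ) ∣ m - p * b ↔ ((p : ℤ) ∣ m ∧ (a : ℤ) ∣ m - p * b) := by
  have hcop : IsCoprime (a : ℤ) (p : ℤ) := Nat.Coprime.isCoprime hap
  push_cast
  constructor
  · intro hdvd
    have ha : (a : ℤ) ∣ m - p * b := (Dvd.intro _ rfl : (a : ℤ) ∣ a * p).trans hdvd
    have hp : (p : ℤ) ∣ m - p * b := (Dvd.intro_left _ rfl : (p : ℤ) ∣ a * p).trans hdvd
    refine ⟨?_, ha⟩
    have : m = (m - p * b) + p * b := by ring
    rw [this]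
    exact dvd_add hp (Dvd.intro _ rfl)
  · rintro ⟨hp, ha⟩
    have hp' : (p : ℤ) ∣ m - p * b := dvd_sub hp (Dvd.intro _ rfl)
    exact hcop.mul_dvd ha hp'

/-! ### Display (2.16): `𝔼 Z_{p,j} = X/p + o(1)` -/

/-- **Tao 2016, display (2.16)** ("(toc)") with an explicit error.  Let `g₁, g₂ : ℕ → ℂ` be
completely multiplicative and unimodular on the positive integers (and `1`-bounded at `0`), let
`p` be a prime not dividing `a`, `1 ≤ j ≤ H`, `b, h ∈ ℤ`, and suppose `|h| + 1 ≤ x/ω` and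
`S = ∑_{x/ω<n≤x} 1/n > 0`.  Then
`|𝔼 c_p 1_{𝐧+j ≡ pb (ap)} g₁(𝐧+j) g₂(𝐧+j+ph) - (1/p) 𝔼 1_{𝐧 ≡ b (a)} g₁(𝐧) g₂(𝐧+h)|`
`  ≤ (8 + 2 log p)/S + 4(H+1)/(pS)`.
Proof as printed: split `1_{𝐧+j ≡ pb (ap)} = 1_{𝐧 ≡ -j (p)} 1_{𝐧+j ≡ pb (a)}`, apply Lemma 2.5
(`q = p`), rewrite the dilated integrand through complete multiplicativity and `c_p g₁(p) g₂(p) = 1`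
as a translate of `1_{𝐧 ≡ b (a)} g₁(𝐧) g₂(𝐧+h)` by `m = (j + (-j mod p))/p ≤ H + 1`, and use the
translation invariance of Lemma 2.5. [cite: TaoFMP2016, Proposition 2.6 (proof, display (2.16))] -/
theorem norm_logAvg_Zpj_sub_le {g₁ g₂ : ℕ → ℂ}
    (hcm₁ : ∀ m n : ℕ, 1 ≤ m → 1 ≤ n → g₁ (m * n) = g₁ m * g₁ n)
    (hcm₂ : ∀ m n : ℕ, 1 ≤ m → 1 ≤ n → g₂ (m * n) = g₂ m * g₂ n)
    (hS₁ : ∀ n : ℕ, 1 ≤ n → ‖g₁ n‖ = 1) (hS₂ : ∀ n : ℕ, 1 ≤ n → ‖g₂ n‖ = 1)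
    (hb₁ : ∀ n, ‖g₁ n‖ ≤ 1) (hb₂ : ∀ n, ‖g₂ n‖ ≤ 1)
    {a p : ℕ} (hp : p.Prime) (hpa : ¬p ∣ a) {H : ℕ} {j : ℤ} (hj1 : 1 ≤ j)
    (hjH : j ≤ H) (b h : ℤ) {x ω : ℝ} (hS : 0 < logWeightSum x ω)
    (hrange : (h.natAbs : ℝ) + 1 ≤ x / ω) :
    ‖logAvg (Zpj a b h g₁ g₂ p j) x ω - 1 / (p : ℂ) * logAvg (corrInd a b h g₁ g₂) x ω‖ ≤
      (8 + 2 * Real.log p) / logWeightSum x ω +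
        4 * ((H : ℝ) + 1) / (p * logWeightSum x ω) := by
  have hp0 : 0 < p := hp.pos
  have hp1 : 1 ≤ p := hp.one_lt.le
  have hap : Nat.Coprime a p := (Nat.Coprime.symm ((Nat.Prime.coprime_iff_not_dvd hp).2 hpa))
  -- the residue `r = -j mod p` and the multiplier `m = (r + j)/p`
  set r : ℕ := ((-j) % p).toNat with hr
  have hpZ : (p : ℤ) ≠ 0 := by exact_mod_cast hp0.ne'
  have hr0 : (0 : ℤ) ≤ (-j) % p := Int.emod_nonneg _ hpZ
  have hrZ : (r : ℤ) = (-j) % p := by rw [hr, Int.toNat_of_nonneg hr0]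
  have hrp : r < p := by
    have : (-j) % p < p := Int.emod_lt_of_pos _ (by exact_mod_cast hp0)
    zify; rw [hrZ]; exact this
  have hdvd_rj : (p : ℤ) ∣ (r : ℤ) + j := by
    rw [hrZ]
    have : (-j) % p + j = (-j) % p - (-j) := by ring
    rw [this, ← Int.modEq_iff_dvd]
    exact (Int.mod_modEq _ _).symm
  obtain ⟨mZ, hmZ⟩ := hdvd_rj
  have hmZ0 : 0 < mZ := by
    have : (0 : ℤ) < (r : ℤ) + j := by have := (Nat.cast_nonneg r : (0 : ℤ) ≤ r); linarith
    rw [hmZ] at this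
    exact pos_of_mul_pos_right this (by exact_mod_cast hp0.le)
  set m : ℕ := mZ.toNat with hm
  have hmZ' : (m : ℤ) = mZ := by rw [hm, Int.toNat_of_nonneg hmZ0.le]
  have hm1 : 1 ≤ m := by zify; rw [hmZ']; exact hmZ0
  have hpm : (p : ℤ) * m = r + j := by rw [hmZ', ← hmZ]
  have hmH : (m : ℝ) ≤ (H : ℝ) + 1 := by
    -- `p m = r + j ≤ (p - 1) + H < p (H + 1)`
    have h1 : (p : ℤ) * m ≤ (p : ℤ) - 1 + H := by
      rw [hpm]; have : (r : ℤ) ≤ p - 1 := by omega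
      linarith
    have h2 : (m : ℤ) ≤ H := by
      by_contra hcon
      push Not at hcon
      have : (p : ℤ) * (H + 1) ≤ (p : ℤ) * m := mul_le_mul_of_nonneg_left (by omega) (by omega)
      nlinarith
    have : (m : ℝ) ≤ H := by exact_mod_cast h2
    linarith
  -- the `a`-part of the integrand
  set Xa : ℕ → ℂ := fun n =>
    if (a : ℤ) ∣ (n : ℤ) + j - p * b then
      cCoeff g₁ g₂ p * g₁ ((n : ℤ) + j).toNat * g₂ ((n : ℤ) + j + p * h).toNat else 0 with hXa
  have hXab : ∀ n, ‖Xa n‖ ≤ 1 := fun n => by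
    simp only [hXa]
    split_ifs
    · rw [norm_mul, norm_mul]
      exact mul_le_one₀ (mul_le_one₀ (norm_cCoeff_le hb₁ hb₂ p) (norm_nonneg _) (hb₁ _))
        (norm_nonneg _) (hb₂ _)
    · simp
  -- Step 1: `Zpj n = 1_{n % p = r} Xa n`
  have hsplit : Zpj a b h g₁ g₂ p j = fun n => if n % p = r then Xa n else 0 := by
    funext n
    simp only [Zpj, hXa]
    have hiff : ((a * p : ℕ) : ℤ) ∣ (n : ℤ) + j - p * b ↔ (n % p = r ∧ (a : ℤ) ∣ (n : ℤ) + j - p * b) := by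
      rw [mul_dvd_sub_iff hap]
      have : (p : ℤ) ∣ (n : ℤ) + j ↔ n % p = r := by
        -- `p ∣ n + j ↔ n ≡ -j (mod p) ↔ n % p = (-j mod p).toNat = r`
        have step : (n : ℤ) ≡ -j [ZMOD p] ↔ n % p = r := by
          constructor
          · intro hmod
            have h1 : ((n % p : ℕ) : ℤ) = (-j) % p := by rw [Int.natCast_mod]; exact hmod
            have h2 := congrArg Int.toNat h1
            rwa [Int.toNat_natCast, ← hr] at h2
          · intro hmod
            show (n : ℤ) % p = (-j) % p
            rw [← Int.natCast_mod, hmod, hrZ]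
        rw [← step, Int.modEq_iff_dvd]
        constructor
        · intro hd; have : -j - (n : ℤ) = -((n : ℤ) + j) := by ring
          rw [this]; exact (dvd_neg).2 hd
        · intro hd; have : (n : ℤ) + j = -(-j - (n : ℤ)) := by ring
          rw [this]; exact (dvd_neg).2 hd
      rw [this]
    by_cases h1 : n % p = r
    · by_cases h2 : (a : ℤ) ∣ (n : ℤ) + j - p * b
      · rw [if_pos (hiff.2 ⟨h1, h2⟩), if_pos h1, if_pos h2]
      · rw [if_neg (fun h' => h2 (hiff.1 h').2), if_pos h1, if_neg h2]
    · rw [if_neg (fun h' => h1 (hiff.1 h').1), if_neg h1]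
  -- Step 2: Lemma 2.5 with `q = p`
  have h25 := norm_logAvg_filter_mod_sub_le hXab hp0 hrp hS (x := x) (ω := ω)
  rw [← hsplit] at h25
  -- Step 3: the dilated integrand is a translate of `V`
  have hωpos : 0 < x / ω := lt_of_lt_of_le (by positivity) hrange
  have hdil : logAvg (fun n => Xa (p * n + r)) x ω = logAvg (fun n => corrInd a b h g₁ g₂ (n + m)) x ω := by
    refine logAvg_congr fun n hn => ?_
    have hn : x / ω < n := lt_of_mem_range hn
    have hnh : (h.natAbs : ℝ) + 1 < n := lt_of_le_of_lt hrange hn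
    have hn1 : 1 ≤ n := by
      have : (1 : ℝ) ≤ n := by have := (Nat.cast_nonneg h.natAbs : (0 : ℝ) ≤ h.natAbs); linarith
      exact_mod_cast this
    -- `k = n + m ≥ 1` and `k + h ≥ 1`
    set k : ℕ := n + m with hk
    have hk1 : 1 ≤ k := le_add_right hn1
    have hkh : 1 ≤ (k : ℤ) + h := by
      have h1 : (h.natAbs : ℤ) + 1 < n := by
        have : ((h.natAbs + 1 : ℕ) : ℝ) < n := by push_cast; exact hnh
        exact_mod_cast (show h.natAbs + 1 < n by exact_mod_cast this)
      have h2 : -h ≤ (h.natAbs : ℤ) := by rw [Int.natCast_natAbs]; exact neg_le_abs h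
      rw [hk]; push_cast; omega
    have hkey : (p : ℤ) * n + r + j = p * k := by rw [hk]; push_cast; linarith [hpm]
    simp only [hXa, corrInd]
    -- the arguments
    have e1 : (((p * n + r : ℕ) : ℤ) + j).toNat = p * k := by
      have : ((p * n + r : ℕ) : ℤ) + j = ((p * k : ℕ) : ℤ) := by push_cast; linarith [hkey]
      rw [this, Int.toNat_natCast]
    have e2 : (((p * n + r : ℕ) : ℤ) + j + p * h).toNat = p * (((k : ℤ) + h).toNat) := by
      have h3 : ((p * n + r : ℕ) : ℤ) + j + p * h = p * ((k : ℤ) + h) := by push_cast; linarith [hkey]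
      rw [h3]
      have h4 : (p : ℤ) * ((k : ℤ) + h) = ((p * ((k : ℤ) + h).toNat : ℕ) : ℤ) := by
        push_cast; rw [Int.toNat_of_nonneg (by linarith)]
      rw [h4, Int.toNat_natCast]
    -- the condition
    have e3 : ((a : ℤ) ∣ ((p * n + r : ℕ) : ℤ) + j - p * b) ↔ ((k : ℤ) ≡ b [ZMOD a]) := by
      have : ((p * n + r : ℕ) : ℤ) + j - p * b = p * ((k : ℤ) - b) := by push_cast; linarith [hkey]
      rw [this, Int.ModEq, eq_comm, ← Int.ModEq, Int.modEq_iff_dvd]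
      constructor
      · intro hd; exact (Nat.Coprime.isCoprime hap).dvd_of_dvd_mul_left hd
      · intro hd; exact hd.mul_left _
    rw [e1, e2]
    by_cases hcond : (k : ℤ) ≡ b [ZMOD a]
    · rw [if_pos (e3.2 hcond), if_pos hcond]
      have ht1 : 1 ≤ ((k : ℤ) + h).toNat := by
        have : ((1 : ℕ) : ℤ) ≤ (((k : ℤ) + h).toNat : ℤ) := by
          rw [Int.toNat_of_nonneg (by linarith)]; exact_mod_cast hkh
        exact_mod_cast this
      rw [hcm₁ p k hp1 hk1, hcm₂ p _ hp1 ht1]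
      have := cCoeff_mul_mul (hS₁ p hp1) (hS₂ p hp1)
      calc cCoeff g₁ g₂ p * (g₁ p * g₁ k) * (g₂ p * g₂ ((k : ℤ) + h).toNat)
          = (cCoeff g₁ g₂ p * g₁ p * g₂ p) * (g₁ k * g₂ ((k : ℤ) + h).toNat) := by ring
        _ = g₁ k * g₂ ((k : ℤ) + h).toNat := by rw [this, one_mul]
    · rw [if_neg (fun h' => hcond (e3.1 h')), if_neg hcond]
  rw [hdil] at h25
  -- Step 4: translation invariance
  have hV := norm_logAvg_shift_up_sub_le (norm_corrInd_le (a := a) (b := b) (h := h) hb₁ hb₂) m hS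
    (x := x) (ω := ω)
  -- Step 5: combine
  have hpR : (0 : ℝ) < p := by exact_mod_cast hp0
  calc ‖logAvg (Zpj a b h g₁ g₂ p j) x ω - 1 / (p : ℂ) * logAvg (corrInd a b h g₁ g₂) x ω‖
      ≤ ‖logAvg (Zpj a b h g₁ g₂ p j) x ω -
            1 / (p : ℂ) * logAvg (fun n => corrInd a b h g₁ g₂ (n + m)) x ω‖ +
          ‖1 / (p : ℂ) * logAvg (fun n => corrInd a b h g₁ g₂ (n + m)) x ω -
            1 / (p : ℂ) * logAvg (corrInd a b h g₁ g₂) x ω‖ := norm_sub_le_norm_sub_add_norm_sub _ _ _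
    _ ≤ (8 + 2 * Real.log p) / logWeightSum x ω + 1 / p * (4 * m / logWeightSum x ω) := by
        refine add_le_add h25 ?_
        rw [← mul_sub, norm_mul, norm_div, norm_one, Complex.norm_natCast]
        exact mul_le_mul_of_nonneg_left hV (by positivity)
    _ ≤ (8 + 2 * Real.log p) / logWeightSum x ω + 4 * ((H : ℝ) + 1) / (p * logWeightSum x ω) := by
        refine add_le_add le_rfl ?_
        have e : 1 / (p : ℝ) * (4 * m / logWeightSum x ω) = 4 * (m : ℝ) / (p * logWeightSum x ω) := by
          field_simp
        rw [e]
        refine div_le_div_of_nonneg_right ?_ (by positivity)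
        nlinarith

end Tao2016

end Literature.NumberTheory.LFunctions
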